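import Summits.Ventures.PercRepro.RankLevelSetLevelSixBasisSq24DN
import Summits.Ventures.PercRepro.RankLevelSetLevelSixBasisSq24Mid1
import Summits.Ventures.PercRepro.RankLevelSetLevelSixBasisSq24Mid2
import Summits.Ventures.PercRepro.RankLevelSetLevelSixBasisRegII24
import Summits.Ventures.PercRepro.RankLevelSetLevelSixBasisSq24Split
import Summits.Ventures.PercRepro.RankLevelSetLevelSixBasisSq24Split7
import Summits.Ventures.PercRepro.RankLevelSetLevelSixBasisSq24Split8
import Summits.Ventures.PercRepro.RankLevelSetLevelSixBasisSq24Split910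
import Summits.Ventures.PercRepro.RankLevelSetLevelSixHeavySq25All

/-!
# PercRepro — C-025 AT LEVEL `6` FOR EVERY `p ≥ 24`, EVERY FINITE MATROID, UNCONDITIONAL: THE 24 ROW (p8 g10, S3)

`proofs/SUBCLAIM-S3-p8.md` §3x. The `e`-free core of rank `24` at every corank `d ≥ 7` is a tree theorem
(`c025_core_six_twentyfour`): `d = 7, 8, 9, 10` by the coloop splits with THE COLOOP-FREE KIT (the coloop-free flat cap, the
coloop-free union bounds, p2's `gb14`, the coloop-free 6- and 7-circuit steps; two levels at `d = 7, 8, 9`, three at `d = 10`),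
`d = 11, 12` by the two-level split on the old caps, `13 ≤ d ≤ 20` by the cell `sq27di` with the nullity-only caps,
`21 ≤ d ≤ 37` by THE BASIS CELL, `d ≥ 38` by regime II with the basis device. With `rls_six_at_of_core 24` on p7's level-`5`
row `c025_five_large_sharp19 (19 ≤ p)` and the `25` row: **`c025_six_large_twenty_four (24 ≤ p) : RLS M p 6`** —
every finite matroid, no corank restriction, unconditional. Axioms: standard.
-/

open scoped Matroid

namespace PercRepro

namespace ThmN

open Set

variable {α : Type}

/-- **The core cell `(24, d)` at every corank `d ≥ 11`, every `e`-free core.** -/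
theorem c025_core_six_twentyfour_large (M : Matroid α) [M.Finite] (d : ℕ) (hd11 : 11 ≤ d)
    (hR : M.eRank = (24 : ℕ∞)) (hn : M.E.ncard = 24 + d)
    (hfree : ∀ e ∈ M.E, ∃ A ⊆ M.E \ {e}, e ∉ M.closure A ∧ e ∉ M.closure ((M.E \ {e}) \ A)) :
    RLS M 24 6 := by
  rcases Nat.lt_or_ge d 13 with h12 | h13
  · exact c025_core_six_twentyfour_eleven_twelve M d hd11 (by omega) hR hn hfree
  rcases Nat.lt_or_ge d 21 with h20 | h21
  · exact c025_core_six_basis_sq24_dn M 24 d (le_refl 24) h13 (by omega) hR hn hfree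
  rcases Nat.lt_or_ge d 30 with h29 | h30
  · exact c025_core_six_basis_sq24_mid1 M d h21 (by omega) hR hn hfree
  rcases Nat.lt_or_ge d 38 with h37 | h38
  · exact c025_core_six_basis_sq24_mid2 M d h30 (by omega) hR hn hfree
  · exact c025_core_six_regII_basis_24 M d h38 hR hn hfree

/-- **The core cell `(24, d)` at every corank `d ≥ 7`, every `e`-free core.** -/
theorem c025_core_six_twentyfour (M : Matroid α) [M.Finite] (d : ℕ) (hd7 : 7 ≤ d)
    (hR : M.eRank = (24 : ℕ∞)) (hn : M.E.ncard = 24 + d)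
    (hfree : ∀ e ∈ M.E, ∃ A ⊆ M.E \ {e}, e ∉ M.closure A ∧ e ∉ M.closure ((M.E \ {e}) \ A)) :
    RLS M 24 6 := by
  rcases Nat.lt_or_ge d 11 with h10 | h11
  · interval_cases d
    · exact c025_core_six_twentyfour_seven M hR hn hfree
    · exact c025_core_six_twentyfour_eight M hR hn hfree
    · exact c025_core_six_twentyfour_nine M hR hn hfree
    · exact c025_core_six_twentyfour_ten M hR hn hfree
  · exact c025_core_six_twentyfour_large M d h11 hR hn hfree

/-- **THEOREM C₆ AT RANK `24`, GIVEN LEVEL `5`**: level `5` for all `p ≥ 23` implies level `6` for all `p ≥ 24`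
(`p = 24` by the core cells above and `rls_six_at_of_core`; `p ≥ 25` by the `25` row). -/
theorem c025_six_of_five_basis_sq24 (h5 : ∀ (M : Matroid α) [M.Finite] (p : ℕ), 23 ≤ p → RLS M p 5) :
    ∀ (M : Matroid α) [M.Finite] (p : ℕ), 24 ≤ p → RLS M p 6 := by
  intro M _ p hp
  rcases Nat.lt_or_ge p 25 with hlt | hge
  · have hP : p = 24 := by omega
    subst hP
    refine rls_six_at_of_core 24 (by norm_num) (fun M _ => h5 M 23 (by norm_num)) ?_ M
    intro M _ d hd hR hn hfree
    exact c025_core_six_twentyfour M d hd hR hn hfree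
  · exact c025_six_large_twenty_five M p hge

/-- **C-025 AT LEVEL `6` FOR EVERY `p ≥ 24`, EVERY FINITE MATROID, UNCONDITIONAL** — `c025_six_of_five_basis_sq24` on
p7's level-`5` row `c025_five_large_sharp19 (19 ≤ p)`. -/
theorem c025_six_large_twenty_four (M : Matroid α) [M.Finite] (p : ℕ) (hp : 24 ≤ p) : RLS M p 6 :=
  c025_six_of_five_basis_sq24 (fun M _ p hp => c025_five_large_sharp19 M p (by omega)) M p hp

/-- The same in the vocabulary of `C025`: the level-`6` frontier is every `p ≥ 24`. -/
theorem c025_six_large_twenty_four' (M : Matroid α) [M.Finite] (p : ℕ) (hp : 24 ≤ p) :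
    phiK p 6 * ({A : Set α | A ⊆ M.E ∧ M.eRk A = (p : ℕ∞) ∧ M.eRk (M.E \ A) = (6 : ℕ∞)}.ncard : ℚ) ≤
      ({A : Set α | A ⊆ M.E ∧ (6 : ℕ∞) < M.eRk A ∧ M.eRk A < (p : ℕ∞)}.ncard : ℚ) :=
  c025_six_large_twenty_four M p hp

end ThmN

end PercRepro
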